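import Mathlib.MeasureTheory.Function.Jacobian
import Mathlib.MeasureTheory.Constructions.HaarToSphere
import Mathlib.Analysis.InnerProductSpace.Calculus
import Mathlib.LinearAlgebra.Matrix.SchurComplement
import Mathlib.Tactic.Module
import HarnessLib

/-!
# The collision cylinder: Lebesgue measure in the coordinates (impact direction, flight time)
(Cercignani–Illner–Pulvirenti 1994, App. 4.A p. 108: "the cylinder change of variables
`x = ε n - τ v`, `dx = ε^{d-1} |v · n| dσ(n) dτ`"; Gallagher–Saint-Raymond–Texier 2013, §4.3
(4.3.6) and Ch. 5 (the parametrisation of the BBGKY collision integrals); Spohn 2006, §3; trunk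
T-KINETIC, topic Analysis/FluidPDE (hard-sphere dynamics); the measure-theoretic core of the
three inputs (S), (R), (Reg) on the hard-sphere dynamics to which the facts
`bodineau_gallagher_saintRaymond_linear` and `bgsr_linearBoltzmannApprox` are reduced in
`TaggedSphereLinearBoltzmannAeInputs` / `TaggedSphereLinearBoltzmannInputs`.)

Fix a radius `ε > 0` and a relative velocity `u` in a finite-dimensional real inner product space
`V` of dimension `n`. A sphere of radius `ε` whose centre moves with velocity `-u` relative to a
point sweeps the *collision cylinder*; the map `(ν, τ) ↦ ε ν + τ u` from (impact direction on the
unit sphere, flight time `τ > 0`) is injective on the hemisphere `⟪u, ν⟫ > 0` (the outgoing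
directions) and Lebesgue measure in these coordinates is `ε^{n-1} ⟪u, ν⟫ dσ(ν) dτ`, `σ` the
surface measure of the unit sphere (`Measure.toSphere`): this is the change of variables behind
the hard-sphere collision operators, behind Alexander's flux argument that almost every boundary
point of the hard-sphere billiard has a regular orbit, and behind the non-singularity of the
parametrisation of the BBGKY pseudo-trajectories (BGSR 2016 p. 15, after Simonella 2014).

This file PROVES it from Mathlib's change-of-variables formula
(`lintegral_image_eq_lintegral_abs_det_fderiv_mul`) and polar coordinates
(`Measure.measurePreserving_homeomorphUnitSphereProd`), through the map
`collisionCylMap ε u y = (ε/‖y‖) y + ‖y‖ u` on `V ∖ {0}` (direction and time encoded by one vector):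

* `LinearMap.det_one_add_smulRight` — the rank-one determinant lemma
  `det (1 + x ⊗ f) = 1 + f x` (from `Matrix.det_one_add_replicateCol_mul_replicateRow`);
* `hasFDerivAt_collisionCylMap`, `det_collisionCylDeriv` — `collisionCylMap ε u` is differentiable off `0` with Jacobian
  determinant `(ε/‖y‖)^{n-1} ⟪u, y⟫/‖y‖`;
* `injOn_collisionCylMap` — injectivity on `{y | 0 < ⟪u, y⟫}`;
* `lintegral_polar` — polar coordinates for `∫⁻`: `∫⁻ y, G y ∂μ = ∫⁻ ν ∂μ.toSphere, ∫⁻ τ in Ioi 0,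
  τ^{n-1} G (τ ν)`;
* `lintegral_collisionCylinder` — **the collision cylinder formula**: for measurable `g ≥ 0`,
  `∫⁻ r in collisionCylRegion ε u, g r ∂μ = ∫⁻ ν ∂μ.toSphere, ∫⁻ τ in Ioi 0, 1_{0 < ⟪u,ν⟫} ε^{n-1} ⟪u, ν⟫ g (ε ν + τ u)`,
  `collisionCylRegion ε u` the open collision cylinder `{ε ν + τ u | ⟪u, ν⟫ > 0, τ > 0}`;
* `toSphere_prod_eq_zero_of_cylinder_null` — hence a set of outgoing (direction, time)
  pairs whose cylinder points form a `μ`-null set is `σ ⊗ dτ`-null.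

## References

* C. Cercignani, R. Illner, M. Pulvirenti, *The Mathematical Theory of Dilute Gases*, Springer
  (1994), §4.3 (4.3.9) and App. 4.A, p. 108.
* I. Gallagher, L. Saint-Raymond, B. Texier, *From Newton to Boltzmann*, EMS (2013),
  arXiv:1208.5753, (4.3.6), Ch. 5.
* H. Spohn, *On the integrated form of the BBGKY hierarchy for hard spheres*,
  arXiv:math-ph/0605068, §3.
-/

open MeasureTheory MeasureTheory.Measure Metric Real Set Filter Function Module
open scoped ENNReal InnerProductSpace Topology

namespace Literature.Analysis.FluidPDE

noncomputable section

section Kinetic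

variable {V : Type*} [NormedAddCommGroup V] [InnerProductSpace ℝ V]

/-! ## §1. The rank-one determinant lemma for linear maps -/

/-- **Rank-one determinant lemma**: `det (1 + x ⊗ f) = 1 + f x` for a linear form `f` and a
vector `x` (`Matrix.det_one_add_replicateCol_mul_replicateRow` in a basis). [folklore] -/
theorem LinearMap.det_one_add_smulRight [FiniteDimensional ℝ V] (f : V →ₗ[ℝ] ℝ) (x : V) :
    LinearMap.det (1 + f.smulRight x) = 1 + f x := by
  classical
  let b := Module.finBasis ℝ V
  rw [← LinearMap.det_toMatrix b, map_add, LinearMap.toMatrix_one, LinearMap.toMatrix_smulRight,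
    Matrix.vecMulVec_eq (Fin 1), Matrix.det_one_add_replicateCol_mul_replicateRow]
  congr 1
  calc (f ∘ b) ⬝ᵥ (b.repr x) = ∑ i, (b.repr x) i * f (b i) := by
        simp [dotProduct, mul_comm]
    _ = f (∑ i, (b.repr x) i • b i) := by rw [_root_.map_sum]; simp
    _ = f x := by rw [b.sum_repr]

/-- `det (c • 1 + x ⊗ f) = c^{n-1} (c + f x)` for `c ≠ 0` (`n = dim V ≥ 1`). [folklore] -/
theorem LinearMap.det_smul_one_add_smulRight [FiniteDimensional ℝ V] [Nontrivial V] {c : ℝ} (hc : c ≠ 0)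
    (f : V →ₗ[ℝ] ℝ) (x : V) :
    LinearMap.det (c • (1 : V →ₗ[ℝ] V) + f.smulRight x) = c ^ (finrank ℝ V - 1) * (c + f x) := by
  have h1 : c • (1 : V →ₗ[ℝ] V) + f.smulRight x = c • (1 + (c⁻¹ • f).smulRight x) := by
    ext v
    simp [smul_add, smul_smul, mul_inv_cancel_left₀ hc]
  rw [h1, LinearMap.det_smul, LinearMap.det_one_add_smulRight]
  have hn : 1 ≤ finrank ℝ V := Module.finrank_pos
  obtain ⟨m, hm⟩ : ∃ m, finrank ℝ V = m + 1 := ⟨finrank ℝ V - 1, by omega⟩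
  rw [hm, Nat.add_sub_cancel, pow_succ]
  simp only [LinearMap.smul_apply, smul_eq_mul]
  field_simp

/-! ## §2. The cylinder map and its Jacobian -/

/-- The **cylinder map** `y ↦ (ε/‖y‖) y + ‖y‖ u`: impact direction `ŷ` and flight time `‖y‖`
encoded by the single vector `y ≠ 0`, sent to the relative position `ε ŷ + ‖y‖ u` of a point
particle that left the sphere of radius `ε` at `ε ŷ` with relative velocity `u` a time `‖y‖`
ago (CIP 1994 App. 4.A "`x = ε n - τ v`" with `v = -u`). [cite: CIP1994, App. 4.A p. 108] -/
def collisionCylMap (ε : ℝ) (u : V) (y : V) : V := (ε / ‖y‖) • y + ‖y‖ • u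

/-- The derivative of the cylinder map at `y ≠ 0`:
`h ↦ (ε/‖y‖) h + ⟪y, h⟫ (‖y‖⁻¹ u - ε ‖y‖⁻³ y)`. [folklore] -/
def collisionCylDeriv (ε : ℝ) (u y : V) : V →L[ℝ] V :=
  (ε / ‖y‖) • ContinuousLinearMap.id ℝ V + (innerSL ℝ y).smulRight (‖y‖⁻¹ • u - (ε / ‖y‖ ^ 3) • y)

/-- `collisionCylDeriv` applied to a vector. [folklore] -/
theorem collisionCylDeriv_apply (ε : ℝ) (u y h : V) :
    collisionCylDeriv ε u y h = (ε / ‖y‖) • h + ⟪y, h⟫_ℝ • (‖y‖⁻¹ • u - (ε / ‖y‖ ^ 3) • y) := by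
  simp [collisionCylDeriv]

/-- The norm is differentiable off the origin with derivative `h ↦ ⟪y, h⟫/‖y‖`. [folklore] -/
theorem hasFDerivAt_norm_of_ne_zero_inner {y : V} (hy : y ≠ 0) :
    HasFDerivAt (fun z : V => ‖z‖) (‖y‖⁻¹ • innerSL ℝ y) y := by
  have h1 := (hasStrictFDerivAt_norm_sq y).hasFDerivAt
  have hy2 : ‖y‖ ^ 2 ≠ 0 := by positivity
  have h2 := (Real.hasDerivAt_sqrt hy2).comp_hasFDerivAt y h1
  have h3 : HasFDerivAt (fun z : V => ‖z‖) ((1 / (2 * ‖y‖)) • (2 : ℕ) • innerSL ℝ y) y := by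
    have := h2
    simp only [Function.comp_def, Real.sqrt_sq_eq_abs, abs_norm] at this
    exact this
  refine h3.congr_fderiv ?_
  have hy0 : ‖y‖ ≠ 0 := norm_ne_zero_iff.2 hy
  rw [two_smul ℕ (innerSL ℝ y), ← two_smul ℝ (innerSL ℝ y), smul_smul]
  congr 1
  field_simp

/-- **The cylinder map is differentiable off the origin**, with derivative `collisionCylDeriv ε u y`. [folklore] -/
theorem hasFDerivAt_collisionCylMap (ε : ℝ) (u : V) {y : V} (hy : y ≠ 0) :
    HasFDerivAt (collisionCylMap ε u) (collisionCylDeriv ε u y) y := by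
  have hy0 : ‖y‖ ≠ 0 := norm_ne_zero_iff.2 hy
  have hn := hasFDerivAt_norm_of_ne_zero_inner hy
  have hinv : HasFDerivAt (fun z : V => ε / ‖z‖) (ε • (-(‖y‖ ^ 2)⁻¹ • (‖y‖⁻¹ • innerSL ℝ y))) y := by
    have h := ((hasDerivAt_inv hy0).comp_hasFDerivAt y hn).const_mul ε
    simpa only [div_eq_mul_inv, Function.comp_def] using h
  have hA : HasFDerivAt (fun z : V => (ε / ‖z‖) • z)
      ((ε / ‖y‖) • ContinuousLinearMap.id ℝ V + (ε • (-(‖y‖ ^ 2)⁻¹ • (‖y‖⁻¹ • innerSL ℝ y))).smulRight y) y :=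
    hinv.smul (hasFDerivAt_id y)
  have hB : HasFDerivAt (fun z : V => ‖z‖ • u) ((‖y‖⁻¹ • innerSL ℝ y).smulRight u) y :=
    hn.smul_const u
  have hsum := hA.add hB
  refine hsum.congr_fderiv ?_
  ext h
  rw [collisionCylDeriv_apply]
  simp only [_root_.add_apply, ContinuousLinearMap.smulRight_apply, _root_.smul_apply, innerSL_apply_apply,
    smul_eq_mul, ContinuousLinearMap.id_apply]
  have e1 : ε * (-(‖y‖ ^ 2)⁻¹ * (‖y‖⁻¹ * ⟪y, h⟫_ℝ)) = -(⟪y, h⟫_ℝ * (ε / ‖y‖ ^ 3)) := by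
    field_simp
  rw [e1]
  module

/-- **The Jacobian determinant of the cylinder map**: `det D(collisionCylMap ε u)(y) = (ε/‖y‖)^{n-1} ⟪u, y⟫/‖y‖`
(`n = dim V`; the rank-one determinant lemma with `c = ε/‖y‖` and
`⟪y, ‖y‖⁻¹ u - ε‖y‖⁻³ y⟫ = ⟪u, y⟫/‖y‖ - ε/‖y‖`) — the factor `ε^{d-1} |v · n|` of CIP 1994
App. 4.A in the encoding `τ = ‖y‖`, `n = y/‖y‖`. [cite: CIP1994, App. 4.A p. 108] -/
theorem det_collisionCylDeriv [FiniteDimensional ℝ V] [Nontrivial V] {ε : ℝ} (hε : ε ≠ 0) (u : V) {y : V} (hy : y ≠ 0) :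
    (collisionCylDeriv ε u y).det = (ε / ‖y‖) ^ (finrank ℝ V - 1) * (⟪u, y⟫_ℝ / ‖y‖) := by
  have hy0 : ‖y‖ ≠ 0 := norm_ne_zero_iff.2 hy
  have hc : ε / ‖y‖ ≠ 0 := div_ne_zero hε hy0
  have hcoe : ((collisionCylDeriv ε u y : V →L[ℝ] V) : V →ₗ[ℝ] V) =
      (ε / ‖y‖) • (1 : V →ₗ[ℝ] V) +
        ((innerSL ℝ y : V →L[ℝ] ℝ) : V →ₗ[ℝ] ℝ).smulRight (‖y‖⁻¹ • u - (ε / ‖y‖ ^ 3) • y) := by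
    ext v
    rw [ContinuousLinearMap.coe_coe, collisionCylDeriv_apply]
    simp
  rw [ContinuousLinearMap.det, hcoe, LinearMap.det_smul_one_add_smulRight hc]
  congr 1
  simp only [ContinuousLinearMap.coe_coe, innerSL_apply_apply, inner_sub_right, inner_smul_right,
    real_inner_self_eq_norm_sq, real_inner_comm u y]
  field_simp
  ring

/-- The cylinder map at `y = τ ν` with `‖ν‖ = 1`, `τ > 0`: `ε ν + τ u`. [folklore] -/
theorem collisionCylMap_smul_unit (ε : ℝ) (u : V) {ν : V} (hν : ‖ν‖ = 1) {τ : ℝ} (hτ : 0 < τ) :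
    collisionCylMap ε u (τ • ν) = ε • ν + τ • u := by
  have : ‖τ • ν‖ = τ := by rw [norm_smul, hν, mul_one, Real.norm_of_nonneg hτ.le]
  rw [collisionCylMap, this, smul_smul, div_mul_cancel₀ ε hτ.ne']

/-- **Injectivity of the cylinder map on the outgoing hemisphere** `{y | 0 < ⟪u, y⟫}`: from
`ε ν₁ + τ₁ u = ε ν₂ + τ₂ u` with unit `νᵢ` and `⟪u, νᵢ⟫ > 0`, pairing with `ν₁ + ν₂` gives
`(τ₂ - τ₁) ⟪u, ν₁ + ν₂⟫ = ε (‖ν₁‖² - ‖ν₂‖²) = 0`, so `τ₁ = τ₂` and then `ν₁ = ν₂` (the line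
`r - τ u` enters the ball of radius `ε` only once). [folklore] -/
theorem injOn_collisionCylMap {ε : ℝ} (hε : 0 < ε) (u : V) : InjOn (collisionCylMap ε u) {y | 0 < ⟪u, y⟫_ℝ} := by
  intro y₁ h₁ y₂ h₂ heq
  simp only [mem_setOf_eq] at h₁ h₂
  have hy₁ : y₁ ≠ 0 := fun h => by simp [h] at h₁
  have hy₂ : y₂ ≠ 0 := fun h => by simp [h] at h₂
  have hn₁ : 0 < ‖y₁‖ := norm_pos_iff.2 hy₁
  have hn₂ : 0 < ‖y₂‖ := norm_pos_iff.2 hy₂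
  set ν₁ : V := ‖y₁‖⁻¹ • y₁ with hν₁
  set ν₂ : V := ‖y₂‖⁻¹ • y₂ with hν₂
  have hν₁n : ‖ν₁‖ = 1 := by rw [hν₁, norm_smul, norm_inv, norm_norm, inv_mul_cancel₀ hn₁.ne']
  have hν₂n : ‖ν₂‖ = 1 := by rw [hν₂, norm_smul, norm_inv, norm_norm, inv_mul_cancel₀ hn₂.ne']
  have hu₁ : 0 < ⟪u, ν₁⟫_ℝ := by rw [hν₁, inner_smul_right]; positivity
  have hu₂ : 0 < ⟪u, ν₂⟫_ℝ := by rw [hν₂, inner_smul_right]; positivity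
  have hy₁e : y₁ = ‖y₁‖ • ν₁ := by rw [hν₁, smul_smul, mul_inv_cancel₀ hn₁.ne', one_smul]
  have hy₂e : y₂ = ‖y₂‖ • ν₂ := by rw [hν₂, smul_smul, mul_inv_cancel₀ hn₂.ne', one_smul]
  have heq' : ε • ν₁ + ‖y₁‖ • u = ε • ν₂ + ‖y₂‖ • u := by
    rw [hy₁e, hy₂e, collisionCylMap_smul_unit ε u hν₁n hn₁, collisionCylMap_smul_unit ε u hν₂n hn₂] at heq
    exact heq
  -- `ε (ν₁ - ν₂) = (‖y₂‖ - ‖y₁‖) u`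
  have hdiff : ε • (ν₁ - ν₂) = (‖y₂‖ - ‖y₁‖) • u := by
    have h : ε • ν₁ + ‖y₁‖ • u - (ε • ν₂ + ‖y₂‖ • u) = 0 := sub_eq_zero.2 heq'
    have h' : ε • (ν₁ - ν₂) - (‖y₂‖ - ‖y₁‖) • u = 0 := by
      rw [← h]; module
    exact sub_eq_zero.1 h'
  -- pair with `ν₁ + ν₂`
  have hτ : ‖y₁‖ = ‖y₂‖ := by
    have h := congrArg (fun w => ⟪w, ν₁ + ν₂⟫_ℝ) hdiff
    simp only [inner_smul_left, inner_sub_left, inner_add_right, real_inner_self_eq_norm_sq, hν₁n, hν₂n,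
      real_inner_comm ν₁ ν₂, RCLike.conj_to_real] at h
    have h0 : (‖y₂‖ - ‖y₁‖) * (⟪u, ν₁⟫_ℝ + ⟪u, ν₂⟫_ℝ) = 0 := by linarith
    rcases mul_eq_zero.1 h0 with h0 | h0
    · linarith
    · linarith
  have hν : ν₁ = ν₂ := by
    rw [hτ, sub_self, zero_smul, smul_eq_zero] at hdiff
    exact sub_eq_zero.1 (hdiff.resolve_left hε.ne')
  rw [hy₁e, hy₂e, hτ, hν]

/-! ## §3. The change of variables in the bulk parameters -/

section Measure

variable [FiniteDimensional ℝ V] [MeasurableSpace V] [BorelSpace V] (μ : Measure V) [μ.IsAddHaarMeasure]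

/-- The **outgoing half-space** of direction–time parameters: `{y | 0 < ⟪u, y⟫}`. [folklore] -/
def collisionCylDom (u : V) : Set V := {y | 0 < ⟪u, y⟫_ℝ}

omit [FiniteDimensional ℝ V] [MeasurableSpace V] [BorelSpace V] in
/-- Membership in the outgoing half-space. [folklore] -/
theorem mem_collisionCylDom {u y : V} : y ∈ collisionCylDom u ↔ 0 < ⟪u, y⟫_ℝ := Iff.rfl

omit [FiniteDimensional ℝ V] [MeasurableSpace V] [BorelSpace V] in
/-- Points of the outgoing half-space are non-zero. [folklore] -/
theorem ne_zero_of_mem_collisionCylDom {u y : V} (hy : y ∈ collisionCylDom u) : y ≠ 0 := by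
  rintro rfl; simp [collisionCylDom] at hy

omit [FiniteDimensional ℝ V] in
/-- The outgoing half-space is measurable (open). [folklore] -/
theorem measurableSet_collisionCylDom (u : V) : MeasurableSet (collisionCylDom u) :=
  (isOpen_lt continuous_const (continuous_const.inner continuous_id)).measurableSet

/-- The **collision cylinder** swept by the sphere of radius `ε` moving with relative velocity
`-u`: the image `{ε ν + τ u | ⟪u, ν⟫ > 0, τ > 0}` of the outgoing half-space under the cylinder
map. [cite: CIP1994, App. 4.A p. 108] -/
def collisionCylRegion (ε : ℝ) (u : V) : Set V := collisionCylMap ε u '' collisionCylDom u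

/-- **Change of variables in the bulk parameters**: for `g ≥ 0`,
`∫⁻_{collisionCylRegion ε u} g dμ = ∫⁻_{collisionCylDom u} (ε/‖y‖)^{n-1} (⟪u,y⟫/‖y‖) g(collisionCylMap ε u y) dμ(y)`
(Mathlib's `lintegral_image_eq_lintegral_abs_det_fderiv_mul` with `det_collisionCylDeriv`,
`injOn_collisionCylMap`). [folklore] -/
theorem lintegral_collisionCylRegion_eq [Nontrivial V] {ε : ℝ} (hε : 0 < ε) (u : V) (g : V → ℝ≥0∞) :
    ∫⁻ r in collisionCylRegion ε u, g r ∂μ =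
      ∫⁻ y in collisionCylDom u, ENNReal.ofReal ((ε / ‖y‖) ^ (finrank ℝ V - 1) * (⟪u, y⟫_ℝ / ‖y‖)) * g (collisionCylMap ε u y) ∂μ := by
  rw [collisionCylRegion, lintegral_image_eq_lintegral_abs_det_fderiv_mul μ (measurableSet_collisionCylDom u)
    (fun y hy => (hasFDerivAt_collisionCylMap ε u (ne_zero_of_mem_collisionCylDom hy)).hasFDerivWithinAt) (injOn_collisionCylMap hε u) g]
  refine setLIntegral_congr_fun (measurableSet_collisionCylDom u) fun y hy => ?_
  have hy0 := ne_zero_of_mem_collisionCylDom hy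
  rw [det_collisionCylDeriv hε.ne' u hy0, abs_of_nonneg]
  have h1 : 0 ≤ ⟪u, y⟫_ℝ / ‖y‖ := div_nonneg (le_of_lt hy) (norm_nonneg _)
  have h2 : 0 ≤ (ε / ‖y‖) ^ (finrank ℝ V - 1) := pow_nonneg (div_nonneg hε.le (norm_nonneg _)) _
  exact mul_nonneg h2 h1

/-! ## §4. Polar coordinates for the lower Lebesgue integral -/

/-- **Polar coordinates**: `∫⁻ y, G y ∂μ = ∫⁻ ν ∂μ.toSphere, ∫⁻ τ in Ioi 0, τ^{n-1} G(τ ν) dτ` for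
measurable `G ≥ 0` (Mathlib's `measurePreserving_homeomorphUnitSphereProd`, `volumeIoiPow`,
Tonelli). [folklore] -/
theorem lintegral_polar [Nontrivial V] (G : V → ℝ≥0∞) (hG : Measurable G) :
    ∫⁻ y, G y ∂μ = ∫⁻ ν : sphere (0 : V) 1, ∫⁻ τ in Ioi (0 : ℝ),
      ENNReal.ofReal (τ ^ (finrank ℝ V - 1)) * G (τ • (ν : V)) ∂volume ∂μ.toSphere := by
  -- remove the origin and pass to the subtype `{0}ᶜ`
  have h1 : ∫⁻ y, G y ∂μ = ∫⁻ x : ({(0 : V)}ᶜ : Set V), G x ∂(μ.comap (↑)) := by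
    rw [lintegral_subtype_comap (measurableSet_singleton _).compl, restrict_compl_singleton]
  -- polar coordinates
  have hmp := μ.measurePreserving_homeomorphUnitSphereProd
  have h2 : ∫⁻ x : ({(0 : V)}ᶜ : Set V), G x ∂(μ.comap (↑)) =
      ∫⁻ p : sphere (0 : V) 1 × Ioi (0 : ℝ), G (p.2.1 • (p.1 : V)) ∂(μ.toSphere.prod (volumeIoiPow (finrank ℝ V - 1))) := by
    have key := hmp.lintegral_comp_emb (Homeomorph.measurableEmbedding _) (fun p => G (p.2.1 • (p.1 : V)))
    rw [← key]
    congr 1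
    funext x
    simp only [homeomorphUnitSphereProd_apply_snd_coe, homeomorphUnitSphereProd_apply_fst_coe]
    rw [smul_smul, mul_inv_cancel₀ (norm_ne_zero_iff.2 x.2), one_smul]
  -- Tonelli and the density `τ^{n-1}`
  have hGm : Measurable fun p : sphere (0 : V) 1 × Ioi (0 : ℝ) => G (p.2.1 • (p.1 : V)) :=
    hG.comp ((measurable_subtype_coe.comp measurable_snd).smul (measurable_subtype_coe.comp measurable_fst))
  rw [h1, h2, lintegral_prod _ hGm.aemeasurable]
  refine lintegral_congr fun ν => ?_
  have hGν : Measurable fun τ : Ioi (0 : ℝ) => G (τ.1 • (ν : V)) :=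
    hG.comp (measurable_subtype_coe.smul measurable_const)
  rw [volumeIoiPow, lintegral_withDensity_eq_lintegral_mul _ (by fun_prop) hGν]
  rw [← lintegral_subtype_comap measurableSet_Ioi (fun τ : ℝ => ENNReal.ofReal (τ ^ (finrank ℝ V - 1)) * G (τ • (ν : V)))]
  rfl

/-! ## §5. The collision cylinder formula -/

omit [FiniteDimensional ℝ V] [MeasurableSpace V] [BorelSpace V] in
/-- `τ ν` lies in the outgoing half-space iff `ν` does (`τ > 0`). [folklore] -/
theorem smul_mem_collisionCylDom_iff {u ν : V} {τ : ℝ} (hτ : 0 < τ) : τ • ν ∈ collisionCylDom u ↔ ν ∈ collisionCylDom u := by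
  simp only [mem_collisionCylDom, inner_smul_right]
  exact ⟨fun h => pos_of_mul_pos_right h hτ.le, fun h => mul_pos hτ h⟩

/-- **The collision cylinder formula** (CIP 1994 App. 4.A: `dx = ε^{d-1} |v · n| dσ(n) dτ`): for
measurable `g ≥ 0`, `∫⁻_{collisionCylRegion ε u} g dμ = ∫⁻ ν ∂μ.toSphere, ∫⁻ τ in Ioi 0,
1_{0 < ⟪u,ν⟫} ε^{n-1} ⟪u, ν⟫ g(ε ν + τ u) dτ`, `μ.toSphere` the surface measure of the unit
sphere induced by the Haar measure `μ`. Proof: the bulk change of variables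
`lintegral_collisionCylRegion_eq` followed by polar coordinates `lintegral_polar`; the radial density
`τ^{n-1}` cancels the factor `(ε/τ)^{n-1}` of the Jacobian exactly.
[cite: CIP1994, App. 4.A p. 108] -/
theorem lintegral_collisionCylinder [Nontrivial V] {ε : ℝ} (hε : 0 < ε) (u : V) (g : V → ℝ≥0∞)
    (hg : Measurable g) :
    ∫⁻ r in collisionCylRegion ε u, g r ∂μ =
      ∫⁻ ν : sphere (0 : V) 1, ∫⁻ τ in Ioi (0 : ℝ),
        (collisionCylDom u).indicator (fun _ => (1 : ℝ≥0∞)) (ν : V) *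
          (ENNReal.ofReal (ε ^ (finrank ℝ V - 1) * ⟪u, (ν : V)⟫_ℝ) * g (ε • (ν : V) + τ • u)) ∂volume ∂μ.toSphere := by
  classical
  set F : V → ℝ≥0∞ := fun y => ENNReal.ofReal ((ε / ‖y‖) ^ (finrank ℝ V - 1) * (⟪u, y⟫_ℝ / ‖y‖)) * g (collisionCylMap ε u y)
    with hF
  have hFm : Measurable F := by
    have h1 : Measurable fun y : V => (ε / ‖y‖) ^ (finrank ℝ V - 1) * (⟪u, y⟫_ℝ / ‖y‖) := by fun_prop
    have h2 : Measurable (collisionCylMap ε u) := by unfold collisionCylMap; fun_prop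
    exact h1.ennreal_ofReal.mul (hg.comp h2)
  rw [lintegral_collisionCylRegion_eq μ hε u g, ← lintegral_indicator (measurableSet_collisionCylDom u),
    lintegral_polar μ _ (hFm.indicator (measurableSet_collisionCylDom u))]
  refine lintegral_congr fun ν => setLIntegral_congr_fun measurableSet_Ioi fun τ hτ => ?_
  have hτ0 : 0 < τ := hτ
  have hν : ‖(ν : V)‖ = 1 := by simp
  by_cases hmem : (ν : V) ∈ collisionCylDom u
  · rw [indicator_of_mem ((smul_mem_collisionCylDom_iff hτ0).2 hmem), indicator_of_mem hmem, one_mul, hF]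
    simp only
    rw [collisionCylMap_smul_unit ε u hν hτ0, norm_smul, hν, mul_one, Real.norm_of_nonneg hτ0.le, inner_smul_right,
      ← mul_assoc, ← ENNReal.ofReal_mul (pow_nonneg hτ0.le _)]
    congr 2
    have hn : 1 ≤ finrank ℝ V := Module.finrank_pos
    obtain ⟨m, hm⟩ : ∃ m, finrank ℝ V = m + 1 := ⟨finrank ℝ V - 1, by omega⟩
    rw [hm, Nat.add_sub_cancel, div_pow]
    field_simp
  · rw [indicator_of_notMem (fun h => hmem ((smul_mem_collisionCylDom_iff hτ0).1 h)), indicator_of_notMem hmem,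
      zero_mul, mul_zero]

/-! ## §6. Null sets in cylinder coordinates -/

/-- **Null sets of outgoing (direction, time) pairs are detected in the bulk**: if `B` is a
set of pairs `(ν, τ)` with `⟪u, ν⟫ > 0`, `τ > 0` whose cylinder points `ε ν + τ u` form a `μ`-null
set, then `B` is null for `μ.toSphere ⊗ dτ` (the weight `ε^{n-1} ⟪u, ν⟫` of the
collision cylinder formula is positive on `B`). This is the form in which Alexander's theorem
("the pathological set is Liouville-null") is transported to the boundary of the hard-sphere
domain along the flux (CIP 1994 App. 4.A; GST 2013 Prop. 4.1.1). [cite: CIP1994, App. 4.A p. 108] -/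
theorem toSphere_prod_eq_zero_of_cylinder_null [Nontrivial V] {ε : ℝ} (hε : 0 < ε) (u : V)
    {B : Set (sphere (0 : V) 1 × ℝ)} (hBu : ∀ p ∈ B, 0 < ⟪u, (p.1 : V)⟫_ℝ ∧ 0 < p.2)
    (hnull : μ ((fun p : sphere (0 : V) 1 × ℝ => ε • (p.1 : V) + p.2 • u) '' B) = 0) :
    (μ.toSphere.prod (volume : Measure ℝ)) B = 0 := by
  classical
  obtain ⟨T, hTsub, hTm, hT0⟩ := exists_measurable_superset_of_null hnull
  -- the cylinder formula for `g = 1_T`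
  have key := lintegral_collisionCylinder μ hε u (T.indicator fun _ => (1 : ℝ≥0∞)) (measurable_one.indicator hTm)
  have hL : ∫⁻ r in collisionCylRegion ε u, T.indicator (fun _ => (1 : ℝ≥0∞)) r ∂μ = 0 := by
    refine le_antisymm ?_ bot_le
    calc ∫⁻ r in collisionCylRegion ε u, T.indicator (fun _ => (1 : ℝ≥0∞)) r ∂μ
        ≤ ∫⁻ r, T.indicator (fun _ => (1 : ℝ≥0∞)) r ∂μ := setLIntegral_le_lintegral _ _
      _ = μ T := by rw [lintegral_indicator hTm]; simp
      _ = 0 := hT0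
  rw [hL] at key
  -- the weight on `B`
  set w : sphere (0 : V) 1 × ℝ → ℝ≥0∞ := fun p =>
    (Ioi (0 : ℝ)).indicator (fun τ => (collisionCylDom u).indicator (fun _ => (1 : ℝ≥0∞)) (p.1 : V) *
      (ENNReal.ofReal (ε ^ (finrank ℝ V - 1) * ⟪u, (p.1 : V)⟫_ℝ) *
        T.indicator (fun _ => (1 : ℝ≥0∞)) (ε • (p.1 : V) + τ • u))) p.2 with hw
  have hwm : Measurable w := by
    have hc : Measurable fun p : sphere (0 : V) 1 × ℝ => (collisionCylDom u).indicator (fun _ => (1 : ℝ≥0∞)) (p.1 : V) :=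
      (measurable_one.indicator (measurableSet_collisionCylDom u)).comp (measurable_subtype_coe.comp measurable_fst)
    have hd : Measurable fun p : sphere (0 : V) 1 × ℝ => ENNReal.ofReal (ε ^ (finrank ℝ V - 1) * ⟪u, (p.1 : V)⟫_ℝ) := by
      fun_prop
    have he : Measurable fun p : sphere (0 : V) 1 × ℝ => T.indicator (fun _ => (1 : ℝ≥0∞)) (ε • (p.1 : V) + p.2 • u) :=
      (measurable_one.indicator hTm).comp (by fun_prop)
    have hprod : Measurable fun p : sphere (0 : V) 1 × ℝ => (collisionCylDom u).indicator (fun _ => (1 : ℝ≥0∞)) (p.1 : V) *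
        (ENNReal.ofReal (ε ^ (finrank ℝ V - 1) * ⟪u, (p.1 : V)⟫_ℝ) *
          T.indicator (fun _ => (1 : ℝ≥0∞)) (ε • (p.1 : V) + p.2 • u)) := hc.mul (hd.mul he)
    have hw' : w = fun p : sphere (0 : V) 1 × ℝ => if p.2 ∈ Ioi (0 : ℝ) then
        (collisionCylDom u).indicator (fun _ => (1 : ℝ≥0∞)) (p.1 : V) *
          (ENNReal.ofReal (ε ^ (finrank ℝ V - 1) * ⟪u, (p.1 : V)⟫_ℝ) *
            T.indicator (fun _ => (1 : ℝ≥0∞)) (ε • (p.1 : V) + p.2 • u)) else 0 := by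
      funext p; rw [hw]; simp only [Set.indicator_apply]
    rw [hw']
    exact Measurable.ite (measurableSet_Ioi.preimage measurable_snd) hprod measurable_const
  have hint : ∫⁻ p, w p ∂(μ.toSphere.prod (volume : Measure ℝ)) = 0 := by
    rw [lintegral_prod _ hwm.aemeasurable, key]
    refine lintegral_congr fun ν => ?_
    rw [← lintegral_indicator measurableSet_Ioi]
  -- on `B` the weight is the positive number `ε^{n-1} ⟪u, ν⟫`
  have hwB : ∀ p ∈ B, w p = ENNReal.ofReal (ε ^ (finrank ℝ V - 1) * ⟪u, (p.1 : V)⟫_ℝ) := by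
    intro p hp
    obtain ⟨hu, hτ⟩ := hBu p hp
    have hmem : (p.1 : V) ∈ collisionCylDom u := hu
    have hT : ε • (p.1 : V) + p.2 • u ∈ T := hTsub ⟨p, hp, rfl⟩
    rw [hw]
    simp only
    rw [indicator_of_mem (show p.2 ∈ Ioi (0 : ℝ) from hτ), indicator_of_mem hmem, indicator_of_mem hT, one_mul,
      mul_one]
  have hpos : ∀ p ∈ B, 0 < w p := by
    intro p hp
    rw [hwB p hp, ENNReal.ofReal_pos]
    exact mul_pos (pow_pos hε _) (hBu p hp).1
  -- hence `B` is null
  have hae : ∀ᵐ p ∂(μ.toSphere.prod (volume : Measure ℝ)), w p = 0 :=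
    (lintegral_eq_zero_iff hwm).1 hint
  have hB0 : ∀ᵐ p ∂(μ.toSphere.prod (volume : Measure ℝ)), p ∉ B := by
    filter_upwards [hae] with p hp hpB
    exact (hpos p hpB).ne' hp
  exact measure_eq_zero_iff_ae_notMem.2 hB0

end Measure

end Kinetic

end

end Literature.Analysis.FluidPDE
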